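import Literature.NumberTheory.EllipticCurves.HasseElementary
import Mathlib.FieldTheory.Finite.Basic
import Mathlib.Data.Nat.Prime.Factorial
import HarnessLib

/-!
# Additive classes X3/X4: elliptic curves with `j ∈ {0, 1728}` over a finite field are ORDINARY when `q ≡ 1 (mod 3)` resp. `(mod 4)`

HONEST FRAMING (cell `b2b-bsdres`, run/shared/lean/b2b/bsd-rank1-residual/, verbatim in every
file): the goal of the cell is to DELETE the COMBINATION-SHAPED residual classes of the
Birch–Swinnerton-Dyer formula for ALL analytic-rank `≤ 1` elliptic curves over `ℚ` — "full BSD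
formula for every rank `≤ 1` curve in class `C`" assembled STRICTLY from published theorems — so
that the rank-`≤ 1` remainder becomes exactly the CONSTRUCTION-SHAPED classes, which are TYPED
(missing-input `Prop`s), NOT attempted. This is not "finishing BSD". Sub-cell `additive-p2`
(X3/X4 at an additive prime, potentially good ORDINARY half): research route; no claim beyond the
stated classes; theorems only, no named fact.

Finite-field half of the kernel ORDINARY refinement of the data dictionary for the
semistability defects `e ∈ {3, 4, 6}` (Kodaira `IV/IV*`, `III/III*`, `II/II*`): over the
semistabilising field such a curve reduces to `j̃ = 0` (`e ∈ {3, 6}`) or `j̃ = 1728` (`e = 4`), and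
an elliptic curve over `𝔽_p` (`p ≥ 5`) with `j = 0` (resp. `1728`) is ORDINARY when
`p ≡ 1 (mod 3)` (resp. `(mod 4)`) — Deuring's criterion (Silverman *AEC* V.4.1(a), Ex. V.4.4–4.5;
Washington §4.6; Ireland–Rosen Ch. 18 §§3–4). Consumer: `CyclotomicGoodOrdinary.lean`.

Method (Euler's criterion; `F` finite with `q` elements, `char F ≠ 2`): the tree's point count
for short Weierstrass curves (`HasseElementary.natCard_point_eq`, `numY_eq`) and Mathlib's
`quadraticChar_eq_pow_of_char_ne_two'` give `q + 1 − #E(F) = −Σ_{x ∈ F} (x³ + a x + b)^{(q−1)/2}`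
in `F`; power sums `Σ_x xⁿ` vanish unless `q − 1 ∣ n`, `n > 0` (`FiniteField.sum_pow_units`), so
for `y² = x³ + b` only `x^{q−1}` survives: `a_E = C((q−1)/2, (q−1)/3)·b^{(q−1)/6}` in `F` when
`3 ∣ q − 1`, and for `y² = x³ + a x`, `a_E = C((q−1)/2, (q−1)/4)·a^{(q−1)/4}` when `4 ∣ q − 1`;
over `𝔽_p` the binomials are prime to `p`. General equations in characteristic `≠ 2, 3` are
brought to short normal form (Mathlib `toShortNF`, same point count by the tree's
`VariableChange.pointEquiv`; `j = 0 ⟺ a₄ = 0`, `j = 1728 ⟺ a₆ = 0`). Main statements: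
`intCast_trace_eq_neg_sum_pow`, `sum_pow_cubic_of_a₄_eq_zero`, `sum_pow_cubic_of_a₆_eq_zero`,
`not_ringChar_dvd_trace_of_j_eq_zero`, `not_ringChar_dvd_trace_of_j_eq` (`j = 1728`),
`not_dvd_trace_of_j_eq_zero_of_card_eq`, `not_dvd_trace_of_j_eq_of_card_eq` (`#F = p ≥ 5`:
`p ∤ p + 1 − #E(F)`, the tree's `HasUnitRootAt` integer).

References: M. Deuring, Abh. Math. Sem. Hamburg 14 (1941) 197–272; J. H. Silverman, *AEC*
Thm. V.4.1(a), Ex. V.4.4, V.4.5; L. C. Washington, *Elliptic Curves* (2nd ed.) §4.6 (Prop. 4.33,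
Thm. 4.34, Prop. 4.37); K. Ireland, M. Rosen, *A Classical Introduction to Modern Number Theory*
Ch. 18 §§3–4; A. W. Knapp, *Elliptic Curves* Thm. 10.5.
-/

noncomputable section

open scoped Classical

open Finset Polynomial WeierstrassCurve Literature.NumberTheory.EllipticCurves.HasseElementary

namespace Summit.BirchSwinnertonDyer.Rank1Residual.Additive

namespace SpecialJ

variable {F : Type*} [Field F] [Fintype F]

/-! ### Power sums over a finite field -/

/-- **Power sums over a finite field**: for `n ≠ 0`, `Σ_{x ∈ F} xⁿ = −1` if `q − 1 ∣ n` and `0`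
otherwise (`q = #F`; Mathlib `FiniteField.sum_pow_units` over `Fˣ`, the term `x = 0` vanishing).
Ireland–Rosen Ch. 18 §3 Lemma; Washington Lemma 4.35. -/
theorem sum_pow_eq_of_ne_zero (n : ℕ) (hn : n ≠ 0) :
    ∑ x : F, x ^ n = if Fintype.card F - 1 ∣ n then -1 else 0 := by
  rw [← FiniteField.sum_pow_units F n]
  let φ : Fˣ ↪ F := ⟨fun x ↦ x, Units.val_injective⟩
  have hφ : univ.map φ = univ \ {0} := by
    ext x
    simp only [mem_map, mem_univ, Function.Embedding.coeFn_mk, true_and, mem_sdiff,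
      mem_singleton, φ]
    constructor
    · rintro ⟨a, rfl⟩
      exact a.ne_zero
    · intro hx
      exact ⟨Units.mk0 x hx, rfl⟩
  calc ∑ x : F, x ^ n = ∑ x ∈ univ \ {(0 : F)}, x ^ n := by
        rw [← sum_sdiff ({0} : Finset F).subset_univ, sum_singleton, zero_pow hn, add_zero]
    _ = ∑ x : Fˣ, ((x : F) ^ n) := by rw [← hφ, sum_map]; rfl

/-- The power sum `Σ_x x^n` for `0 < n < 2(q − 1)`: it is `−1` exactly when `n = q − 1`. -/
theorem sum_pow_eq_ite_eq (n : ℕ) (hn : n ≠ 0) (hlt : n < 2 * (Fintype.card F - 1)) :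
    ∑ x : F, x ^ n = if n = Fintype.card F - 1 then -1 else 0 := by
  rw [sum_pow_eq_of_ne_zero n hn]
  by_cases h : n = Fintype.card F - 1
  · rw [if_pos h, if_pos (h ▸ dvd_refl n)]
  · rw [if_neg h, if_neg]
    rintro ⟨c, rfl⟩
    rcases c with _ | _ | c
    · exact hn (mul_zero _)
    · exact h (mul_one _)
    · have := Nat.mul_le_mul_left (Fintype.card F - 1) (show 2 ≤ c + 1 + 1 by omega)
      omega

/-! ### The trace of a short Weierstrass curve modulo the characteristic -/

section ShortNF

variable (E : WeierstrassCurve F) [E.IsShortNF] [E.IsElliptic]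

/-- **The trace as a character sum**: for `E : y² = x³ + a x + b` over a finite field of odd
characteristic, `q + 1 − #E(F) = −Σ_{x ∈ F} χ(x³ + a x + b)` with `χ` the quadratic character
(from the tree's `natCard_point_eq` and `numY_eq`). Washington Thm. 4.14 proof; Ireland–Rosen
Ch. 18 §4. -/
theorem trace_eq_neg_sum_quadraticChar (hF : ringChar F ≠ 2) :
    ((Fintype.card F : ℤ) + 1 - Nat.card E.toAffine.Point) =
      -∑ x : F, (quadraticChar F ((cubic E).eval x) : ℤ) := by
  rw [natCard_point_eq E]
  push_cast
  simp_rw [numY_eq E hF]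
  rw [sum_add_distrib, sum_const, card_univ, nsmul_eq_mul, mul_one]
  ring

/-- **Euler's criterion form of the trace**: in `F`, `q + 1 − #E(F) = −Σ_{x ∈ F} (x³ + a x + b)^{⌊q/2⌋}`
(`χ(t) = t^{(q−1)/2}`, Mathlib `quadraticChar_eq_pow_of_char_ne_two'`). This is the congruence
"`a_E ≡` Hasse invariant" of Silverman *AEC* V.4.1(a) / Washington Thm. 4.34 in the form needed
here. -/
theorem intCast_trace_eq_neg_sum_pow (hF : ringChar F ≠ 2) :
    (((Fintype.card F : ℤ) + 1 - Nat.card E.toAffine.Point : ℤ) : F) =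
      -∑ x : F, ((cubic E).eval x) ^ (Fintype.card F / 2) := by
  rw [trace_eq_neg_sum_quadraticChar E hF]
  push_cast
  simp_rw [quadraticChar_eq_pow_of_char_ne_two' hF]

omit [E.IsShortNF] [E.IsElliptic] in
/-- **`j = 0` (`y² = x³ + b`)**: `Σ_{x ∈ F} (x³ + b)^m = −C(m, (q−1)/3)·b^{m − (q−1)/3}` when
`3 ∣ q − 1`, where `m = ⌊q/2⌋ = (q−1)/2` (only the monomial `x^{q−1}` of the binomial expansion
has a nonzero power sum). Ireland–Rosen Ch. 18 §3; Washington §4.6. -/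
theorem sum_pow_cubic_of_a₄_eq_zero (hF : ringChar F ≠ 2) (ha : E.a₄ = 0)
    (h3 : 3 ∣ Fintype.card F - 1) :
    ∑ x : F, ((cubic E).eval x) ^ (Fintype.card F / 2) =
      -((((Fintype.card F / 2).choose ((Fintype.card F - 1) / 3) : ℕ) : F) *
        E.a₆ ^ (Fintype.card F / 2 - (Fintype.card F - 1) / 3)) := by
  set q := Fintype.card F with hqdef
  set m := q / 2 with hmdef
  have hq : q = 2 * m + 1 := card_eq_two_mul_add_one hF
  have hq1 : q - 1 = 2 * m := by omega
  obtain ⟨k₀, hk₀⟩ := h3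
  have hk₀' : (q - 1) / 3 = k₀ := by rw [hk₀]; simp
  have hm0 : 0 < m := by
    have := Fintype.one_lt_card (α := F)
    omega
  have hk₀pos : 0 < k₀ := by omega
  have hk₀le : k₀ ≤ m := by omega
  rw [hk₀']
  -- expand `(x³ + b)^m`
  have hexp : ∀ x : F, ((cubic E).eval x) ^ m =
      ∑ k ∈ range (m + 1), (m.choose k : F) * E.a₆ ^ (m - k) * x ^ (3 * k) := by
    intro x
    rw [eval_cubic, ha, zero_mul, add_zero, add_pow]
    refine sum_congr rfl fun k _ ↦ ?_
    rw [← pow_mul]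
    ring
  simp_rw [hexp]
  rw [sum_comm]
  -- the inner power sums
  have hinner : ∀ k ∈ range (m + 1),
      ∑ x : F, (m.choose k : F) * E.a₆ ^ (m - k) * x ^ (3 * k) =
        if k = k₀ then -((m.choose k₀ : F) * E.a₆ ^ (m - k₀)) else 0 := by
    intro k hk
    rw [mem_range] at hk
    rw [← mul_sum]
    by_cases hk0 : k = 0
    · subst hk0
      have hne : (0 : ℕ) ≠ k₀ := by omega
      rw [if_neg hne]
      simp only [mul_zero, pow_zero, sum_const, card_univ, nsmul_eq_mul, mul_one]
      rw [← hqdef, FiniteField.cast_card_eq_zero, mul_zero]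
    · rw [sum_pow_eq_ite_eq (3 * k) (by omega) (by omega)]
      by_cases hkk : k = k₀
      · subst hkk
        rw [if_pos (by omega), if_pos rfl, mul_neg, mul_one]
      · rw [if_neg (by omega), if_neg hkk, mul_zero]
  rw [sum_congr rfl hinner, sum_ite_eq' (range (m + 1)) k₀, if_pos (mem_range.mpr (by omega))]

omit [E.IsShortNF] [E.IsElliptic] in
/-- **`j = 1728` (`y² = x³ + a x`)**: `Σ_{x ∈ F} (x³ + a x)^m = −C(m, m/2)·a^{m − m/2}` when
`4 ∣ q − 1` (`m = (q−1)/2` even; only the monomial `x^{m + 2·(m/2)} = x^{q−1}` survives).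
Ireland–Rosen Ch. 18 §4; Washington §4.6. -/
theorem sum_pow_cubic_of_a₆_eq_zero (hF : ringChar F ≠ 2) (hb : E.a₆ = 0)
    (h4 : 4 ∣ Fintype.card F - 1) :
    ∑ x : F, ((cubic E).eval x) ^ (Fintype.card F / 2) =
      -((((Fintype.card F / 2).choose ((Fintype.card F - 1) / 4) : ℕ) : F) *
        E.a₄ ^ (Fintype.card F / 2 - (Fintype.card F - 1) / 4)) := by
  set q := Fintype.card F with hqdef
  set m := q / 2 with hmdef
  have hq : q = 2 * m + 1 := card_eq_two_mul_add_one hF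
  have hq1 : q - 1 = 2 * m := by omega
  obtain ⟨k₀, hk₀⟩ := h4
  have hk₀' : (q - 1) / 4 = k₀ := by rw [hk₀]; simp
  have hm0 : 0 < m := by
    have := Fintype.one_lt_card (α := F)
    omega
  have hmk : m = 2 * k₀ := by omega
  have hk₀le : k₀ ≤ m := by omega
  rw [hk₀']
  -- expand `(x³ + a x)^m = Σ_k C(m,k) a^{m-k} x^{m + 2k}`
  have hexp : ∀ x : F, ((cubic E).eval x) ^ m =
      ∑ k ∈ range (m + 1), (m.choose k : F) * E.a₄ ^ (m - k) * x ^ (m + 2 * k) := by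
    intro x
    rw [eval_cubic, hb, add_zero, add_pow]
    refine sum_congr rfl fun k hk ↦ ?_
    rw [mem_range] at hk
    rw [mul_pow, ← pow_mul]
    have : x ^ (3 * k) * x ^ (m - k) = x ^ (m + 2 * k) := by
      rw [← pow_add]; congr 1; omega
    calc x ^ (3 * k) * (E.a₄ ^ (m - k) * x ^ (m - k)) * (m.choose k : F)
        = (m.choose k : F) * E.a₄ ^ (m - k) * (x ^ (3 * k) * x ^ (m - k)) := by ring
      _ = (m.choose k : F) * E.a₄ ^ (m - k) * x ^ (m + 2 * k) := by rw [this]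
  simp_rw [hexp]
  rw [sum_comm]
  have hinner : ∀ k ∈ range (m + 1),
      ∑ x : F, (m.choose k : F) * E.a₄ ^ (m - k) * x ^ (m + 2 * k) =
        if k = k₀ then -((m.choose k₀ : F) * E.a₄ ^ (m - k₀)) else 0 := by
    intro k hk
    rw [mem_range] at hk
    rw [← mul_sum, sum_pow_eq_ite_eq (m + 2 * k) (by omega) (by omega)]
    by_cases hkk : k = k₀
    · subst hkk
      rw [if_pos (by omega), if_pos rfl, mul_neg, mul_one]
    · rw [if_neg (by omega), if_neg hkk, mul_zero]
  rw [sum_congr rfl hinner, sum_ite_eq' (range (m + 1)) k₀, if_pos (mem_range.mpr (by omega))]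

/-- **`y² = x³ + b` is ordinary when `q ≡ 1 (mod 3)` and `C((q−1)/2, (q−1)/3) ≠ 0` in `F`**: the
characteristic does not divide `q + 1 − #E(F)`. (Over `𝔽_p` the binomial condition is automatic,
`not_dvd_trace_of_j_eq_zero_of_card_eq`; over `𝔽_{p^f}` it encodes `p ≡ 1 (mod 3)` by Lucas.)
Silverman *AEC* Ex. V.4.4; Washington Prop. 4.33 / §4.6. -/
theorem not_ringChar_dvd_trace_of_a₄_eq_zero (hF : ringChar F ≠ 2) (ha : E.a₄ = 0)
    (h3 : 3 ∣ Fintype.card F - 1)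
    (hch : (((Fintype.card F / 2).choose ((Fintype.card F - 1) / 3) : ℕ) : F) ≠ 0) :
    ¬ ((ringChar F : ℤ) ∣ (Fintype.card F : ℤ) + 1 - Nat.card E.toAffine.Point) := by
  intro hdvd
  have h0 : (((Fintype.card F : ℤ) + 1 - Nat.card E.toAffine.Point : ℤ) : F) = 0 :=
    (CharP.intCast_eq_zero_iff F (ringChar F) _).mpr hdvd
  rw [intCast_trace_eq_neg_sum_pow E hF, sum_pow_cubic_of_a₄_eq_zero E hF ha h3, neg_neg] at h0
  have hb : E.a₆ ≠ 0 := fun hb ↦ E.isUnit_Δ.ne_zero (by rw [E.Δ_of_isShortNF, ha, hb]; ring)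
  exact (mul_ne_zero hch (pow_ne_zero _ hb)) h0

/-- **`y² = x³ + a x` is ordinary when `q ≡ 1 (mod 4)` and `C((q−1)/2, (q−1)/4) ≠ 0` in `F`.**
Silverman *AEC* Ex. V.4.5; Washington Prop. 4.37 / §4.6. -/
theorem not_ringChar_dvd_trace_of_a₆_eq_zero (hF : ringChar F ≠ 2) (hb : E.a₆ = 0)
    (h4 : 4 ∣ Fintype.card F - 1)
    (hch : (((Fintype.card F / 2).choose ((Fintype.card F - 1) / 4) : ℕ) : F) ≠ 0) :
    ¬ ((ringChar F : ℤ) ∣ (Fintype.card F : ℤ) + 1 - Nat.card E.toAffine.Point) := by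
  intro hdvd
  have h0 : (((Fintype.card F : ℤ) + 1 - Nat.card E.toAffine.Point : ℤ) : F) = 0 :=
    (CharP.intCast_eq_zero_iff F (ringChar F) _).mpr hdvd
  rw [intCast_trace_eq_neg_sum_pow E hF, sum_pow_cubic_of_a₆_eq_zero E hF hb h4, neg_neg] at h0
  have ha : E.a₄ ≠ 0 := fun ha ↦ E.isUnit_Δ.ne_zero (by rw [E.Δ_of_isShortNF, ha, hb]; ring)
  exact (mul_ne_zero hch (pow_ne_zero _ ha)) h0

end ShortNF

/-! ### General Weierstrass equations in characteristic `≠ 2, 3` -/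

section General

variable (E : WeierstrassCurve F) [E.IsElliptic]

omit [Fintype F] [E.IsElliptic] in
/-- In characteristic `≠ 2, 3` the constants `2, 3` are nonzero in `F`. -/
theorem two_ne_zero_and_three_ne_zero (h2 : ringChar F ≠ 2) (h3 : ringChar F ≠ 3) :
    (2 : F) ≠ 0 ∧ (3 : F) ≠ 0 := by
  refine ⟨Ring.two_ne_zero h2, fun h ↦ ?_⟩
  have hdvd : ringChar F ∣ 3 := (ringChar.spec F 3).mp (by exact_mod_cast h)
  rcases (Nat.dvd_prime Nat.prime_three).mp hdvd with h1 | h1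
  · exact CharP.ringChar_ne_one h1
  · exact h3 h1

/-- **An elliptic curve with `j = 0` over a finite field of characteristic `≠ 2, 3` with
`q ≡ 1 (mod 3)` is ordinary** (given `C((q−1)/2, (q−1)/3) ≠ 0` in `F`, automatic over `𝔽_p`):
`char F ∤ q + 1 − #E(F)`. Reduction to the short normal form `E.toShortNF • E` (same point count,
tree `VariableChange.pointEquiv`; `j = 0 ⟺ c₄ = 0 ⟺ a₄ = 0`). Deuring 1941; Silverman *AEC*
V.4.1(a) + Ex. V.4.4. -/
theorem not_ringChar_dvd_trace_of_j_eq_zero (h2 : ringChar F ≠ 2) (h3 : ringChar F ≠ 3)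
    (hj : E.j = 0) (hq : 3 ∣ Fintype.card F - 1)
    (hch : (((Fintype.card F / 2).choose ((Fintype.card F - 1) / 3) : ℕ) : F) ≠ 0) :
    ¬ ((ringChar F : ℤ) ∣ (Fintype.card F : ℤ) + 1 - Nat.card E.toAffine.Point) := by
  obtain ⟨h2', h3'⟩ := two_ne_zero_and_three_ne_zero h2 h3
  haveI : Invertible (2 : F) := invertibleOfNonzero h2'
  haveI : Invertible (3 : F) := invertibleOfNonzero h3'
  haveI : (E.toShortNF • E).IsShortNF := E.toShortNF_spec
  have hjS : (E.toShortNF • E).j = 0 := by rw [variableChange_j, hj]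
  have hc4 : (E.toShortNF • E).c₄ = 0 := (j_eq_zero_iff _).mp hjS
  have ha4 : (E.toShortNF • E).a₄ = 0 := by
    rw [(E.toShortNF • E).c₄_of_isShortNF] at hc4
    have h48 : (-48 : F) ≠ 0 := by
      rw [show (-48 : F) = -(2 ^ 4 * 3) by norm_num]
      exact neg_ne_zero.mpr (mul_ne_zero (pow_ne_zero _ h2') h3')
    exact (mul_eq_zero.mp hc4).resolve_left h48
  rw [Nat.card_congr (VariableChange.pointEquiv E E.toShortNF).toEquiv]
  exact not_ringChar_dvd_trace_of_a₄_eq_zero (E.toShortNF • E) h2 ha4 hq hch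

/-- `j − 1728 = c₆² / Δ` for an elliptic curve (from `1728 Δ = c₄³ − c₆²`): so `j = 1728 ⟺ c₆ = 0`
over a field. Silverman *AEC* III.1, p. 42. -/
theorem j_eq_iff_c₆_eq_zero {K : Type*} [Field K] (V : WeierstrassCurve K) [V.IsElliptic] :
    V.j = 1728 ↔ V.c₆ = 0 := by
  have hΔ : (V.Δ : K) ≠ 0 := V.isUnit_Δ.ne_zero
  have hj : V.j = V.c₄ ^ 3 / V.Δ := by
    rw [WeierstrassCurve.j, ← coe_Δ', div_eq_inv_mul, Units.val_inv_eq_inv_val]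
  have hrel := V.c_relation
  constructor
  · intro h
    rw [hj, div_eq_iff hΔ] at h
    have : V.c₆ ^ 2 = 0 := by linear_combination hrel + h
    exact pow_eq_zero_iff two_ne_zero |>.mp this
  · intro h
    rw [hj, div_eq_iff hΔ]
    rw [h] at hrel
    linear_combination -hrel

/-- **An elliptic curve with `j = 1728` over a finite field of characteristic `≠ 2, 3` with
`q ≡ 1 (mod 4)` is ordinary** (given `C((q−1)/2, (q−1)/4) ≠ 0` in `F`): `char F ∤ q + 1 − #E(F)`.
Deuring 1941; Silverman *AEC* V.4.1(a) + Ex. V.4.5. -/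
theorem not_ringChar_dvd_trace_of_j_eq (h2 : ringChar F ≠ 2) (h3 : ringChar F ≠ 3)
    (hj : E.j = 1728) (hq : 4 ∣ Fintype.card F - 1)
    (hch : (((Fintype.card F / 2).choose ((Fintype.card F - 1) / 4) : ℕ) : F) ≠ 0) :
    ¬ ((ringChar F : ℤ) ∣ (Fintype.card F : ℤ) + 1 - Nat.card E.toAffine.Point) := by
  obtain ⟨h2', h3'⟩ := two_ne_zero_and_three_ne_zero h2 h3
  haveI : Invertible (2 : F) := invertibleOfNonzero h2'
  haveI : Invertible (3 : F) := invertibleOfNonzero h3'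
  haveI : (E.toShortNF • E).IsShortNF := E.toShortNF_spec
  have hjS : (E.toShortNF • E).j = 1728 := by rw [variableChange_j, hj]
  have hc6 : (E.toShortNF • E).c₆ = 0 := (j_eq_iff_c₆_eq_zero _).mp hjS
  have ha6 : (E.toShortNF • E).a₆ = 0 := by
    rw [(E.toShortNF • E).c₆_of_isShortNF] at hc6
    have h864 : (-864 : F) ≠ 0 := by
      rw [show (-864 : F) = -(2 ^ 5 * 3 ^ 3) by norm_num]
      exact neg_ne_zero.mpr (mul_ne_zero (pow_ne_zero _ h2') (pow_ne_zero _ h3'))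
    exact (mul_eq_zero.mp hc6).resolve_left h864
  rw [Nat.card_congr (VariableChange.pointEquiv E E.toShortNF).toEquiv]
  exact not_ringChar_dvd_trace_of_a₆_eq_zero (E.toShortNF • E) h2 ha6 hq hch

end General

/-! ### Over the prime field `𝔽_p`, `p ≥ 5` -/

section PrimeField

variable {k : Type*} [Field k] [Finite k] (E : WeierstrassCurve k) [E.IsElliptic] {p : ℕ}

omit [Finite k] in
/-- A finite field with a prime number `p` of elements has characteristic `p` (and `Fintype.card = p`). -/
theorem ringChar_eq_of_natCard_eq [Fintype k] (hp : p.Prime) (hcard : Nat.card k = p) :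
    ringChar k = p ∧ Fintype.card k = p := by
  have hq : Fintype.card k = p := by rw [← Nat.card_eq_fintype_card, hcard]
  obtain ⟨n, -, hn⟩ := FiniteField.card k (ringChar k)
  rw [hq] at hn
  exact ⟨((Nat.Prime.pow_eq_iff hp).mp hn.symm).1, hq⟩

omit [Finite k] in
/-- Binomial coefficients `C(n, j)` with `n < p` are nonzero in a field of characteristic `p`. -/
theorem natCast_choose_ne_zero_of_lt (hp : p.Prime) (hchar : ringChar k = p) {n j : ℕ}
    (hj : j ≤ n) (hn : n < p) : ((n.choose j : ℕ) : k) ≠ 0 := by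
  intro h
  have hdvd : p ∣ n.choose j := by rw [← hchar]; exact (ringChar.spec k _).mp h
  have hfac : p ∣ n.factorial := by
    rw [← Nat.choose_mul_factorial_mul_factorial hj, mul_assoc]
    exact dvd_mul_of_dvd_left hdvd _
  exact absurd ((Nat.Prime.dvd_factorial hp).mp hfac) (not_le.mpr hn)

/-- **Ordinary reduction for `j = 0` over `𝔽_p`, `p ≥ 5`, `p ≡ 1 (mod 3)`**: for an elliptic curve
`E` over a field `k` with `p` elements and `j(E) = 0`, `p ∤ p + 1 − #E(k)` — the unit-root /
ordinary condition of the tree's `WeierstrassCurve.HasUnitRootAt`. Deuring 1941; Silverman *AEC*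
V.4.1(a), Ex. V.4.4 ("`y² = x³ + 1` is supersingular iff `p ≡ 2 (mod 3)`"). -/
theorem not_dvd_trace_of_j_eq_zero_of_card_eq (hp : p.Prime) (hp5 : 5 ≤ p)
    (hcard : Nat.card k = p) (hj : E.j = 0) (h3 : 3 ∣ p - 1) :
    ¬ ((p : ℤ) ∣ (Nat.card k : ℤ) + 1 - Nat.card E.toAffine.Point) := by
  haveI := Fintype.ofFinite k
  obtain ⟨hchar, hq⟩ := ringChar_eq_of_natCard_eq (k := k) hp hcard
  have hch : (((Fintype.card k / 2).choose ((Fintype.card k - 1) / 3) : ℕ) : k) ≠ 0 := by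
    rw [hq]; exact natCast_choose_ne_zero_of_lt hp hchar (by omega) (by omega)
  have h := not_ringChar_dvd_trace_of_j_eq_zero E (by omega) (by omega) hj (hq ▸ h3) hch
  rw [hchar, hq] at h
  rw [hcard]
  exact h

/-- **Ordinary reduction for `j = 1728` over `𝔽_p`, `p ≥ 5`, `p ≡ 1 (mod 4)`**: for an elliptic
curve `E` over a field `k` with `p` elements and `j(E) = 1728`, `p ∤ p + 1 − #E(k)`. Deuring 1941;
Silverman *AEC* V.4.1(a), Ex. V.4.5 ("`y² = x³ + x` is supersingular iff `p ≡ 3 (mod 4)`"). -/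
theorem not_dvd_trace_of_j_eq_of_card_eq (hp : p.Prime) (hp5 : 5 ≤ p)
    (hcard : Nat.card k = p) (hj : E.j = 1728) (h4 : 4 ∣ p - 1) :
    ¬ ((p : ℤ) ∣ (Nat.card k : ℤ) + 1 - Nat.card E.toAffine.Point) := by
  haveI := Fintype.ofFinite k
  obtain ⟨hchar, hq⟩ := ringChar_eq_of_natCard_eq (k := k) hp hcard
  have hch : (((Fintype.card k / 2).choose ((Fintype.card k - 1) / 4) : ℕ) : k) ≠ 0 := by
    rw [hq]; exact natCast_choose_ne_zero_of_lt hp hchar (by omega) (by omega)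
  have h := not_ringChar_dvd_trace_of_j_eq E (by omega) (by omega) hj (hq ▸ h4) hch
  rw [hchar, hq] at h
  rw [hcard]
  exact h

end PrimeField

end SpecialJ

end Summit.BirchSwinnertonDyer.Rank1Residual.Additive

end
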